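/-
Copyright (c) 2026 the pub-hodgecm-mathlib formalisation cell (harness21).  Prover seat hodgecm-mathlib-K2E3-p14 (g2), Track B «K2-LIT» ∕ h413
(`stmt-HodgeConjecture-24833`), unit U12 «Harish-Chandra characters» of the line `K2_E3_EllipticInputs`, socket U12-h ‹#9L› `sig_K2E3CharLocConstNearRegular`:
package (P-GL) `K2E3ParameterPackageGL` of the 9L line lead's MEMO v5 §2 (K2E3-p09 (g2), K2 bus 2026-09-03T23:55:34Z), free-hand take 23:58Z.  2026-09-04.
-/
import Summits.HodgeConjecture.HodgeConjecture.Theorems.K2E3CongruenceFrameGL                     -- ★ p855840 (this seat): levels `Kf m := (congruenceGL n |ϖ|^m).comap e` along `e : G ≃ₜ* GL_n(F)`; brings ★ part 1, ★ p855559 (C), ★ p855532 (H-char), ★ `GLnCongruenceSubgroups`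
import Summits.HodgeConjecture.HodgeConjecture.Theorems.K2E3CongruenceLayerAdapters               -- ★ p855679 (K2E1b-p08): (S)-adapter `exists_valBound_and_forall_eq_coe_map_trace` (complex-valued layer characters are `χ_X`)
import Summits.HodgeConjecture.HodgeConjecture.Theorems.K2E3CongruenceLayerOccurrenceNilpotentGL  -- ★ p855641 (K2E1b-p08): (N) `exists_nilpotent_add_valBound_of_occurrence`
import Summits.HodgeConjecture.HodgeConjecture.Theorems.K2E3RegularAdjointConeEstimates           -- ★ p855727 (K2E1b-p08): (hA) `norm_conj_sub_le_of_le`; brings ★ `Literature.Analysis.Matrix.norm_mul_le_of_isUltrametricDist` (elementwise sup norm)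
import HarnessLib

/-!
# Crux `H413` — K2-LIT E3 «EllipticInputs», U12-h package (P-GL): THE PARAMETER PACKAGE ALONG `e : G ≃ₜ* GL_n(F)` — the brick hypotheses `hS`, `hnd` (one-sided),
# `hconjCh`, `hiso`, `hcontr`, `hint` (`H = 2h`), `hocc` (`E = 0`), `h𝒩`, `hSAd` (`S = univ`) of ★ p855853 `exists_nhds_levelTraceStable_of_bricks_defect` at a SPLIT frame,
# from the ★ GL bricks (S)∕(H-char)∕(C)∕(N)∕(hA) and three DICTIONARY clauses (ValBound ↔ norm), for an ABSTRACT `Ad`∕`Ch` pinned by their defining equations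

Cell `hodgecm-mathlib`, Track B «K2-LIT», crux item `stmt-HodgeConjecture-24833` (h413), line `K2_E3_EllipticInputs`, unit U12 «HC characters», socket U12-h
`sig_K2E3CharLocConstNearRegular` (‹#9L›).  MEMO v5 `K2/K2E3-p09/g2/MEMO-U12h-frame-assembly.v5` §1–§2 (K2E3-p09 (g2)): per-place model `e : G ≃ₜ* U`, here `U = ⊤ ≅ GL_N(F)`
(split `v`, ★ `localSplitEquiv`), `Kf m := (congruenceGL N (valuation F ϖ ^ m)).comap e` (★ p855840), `𝔤 := Matrix (Fin N) (Fin N) F` with the scoped elementwise sup norm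
(`open scoped Matrix.Norms.Elementwise`, ★ (L6-inst) currency), `Ad x := X ↦ (e x) X (e x)⁻¹`, `Ch X g := ((ψ (tr (X * ((e g : GL) − 1))) : Circle) : ℂ)` for `ψ : AddChar F Circle` of conductor
`𝒪`, `𝒩 := {Z | IsNilpotent Z}`, `S := univ`, and a real `q > 1` (`= ‖ϖ‖⁻¹`) tied to the valuation by the (Dict) package `K2E3LocalFieldNormDictionary` (K2E1b-p01 (g3)).  THIS FILE delivers
each parameter binder IN THE EXACT SHAPE OF ★ p855915 `exists_levelTraceStable_GL` (K2E3-p09's [Assembly] at a split-type frame: `Ad` concrete as `X ↦ (e x) X (e x)⁻¹`, `Ch` a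
variable — here pinned only by its defining equation `hCh`, so [Assembly]'s concrete `Ch` docks by `fun _ _ => rfl`), over a field `F` carrying BOTH a `NontriviallyNormedField` structure and a `ValuativeRel`, linked by the three (Dict) clauses
taken as HYPOTHESES in (Dict)'s announced shapes: `hdict : ValBound ((valuation F ϖ)^m)⁻¹ X ↔ ‖X‖ ≤ q^m`, `hint1 : k ∈ GL_n(𝒪) → ‖↑k‖ ≤ 1`, `hlev : k ∈ K_m → ‖↑k − 1‖ ≤ (q^m)⁻¹`
([Assembly] discharges them from ★ (Dict) after `letI := Valued.toNontriviallyNormedField L_w ℤᵐ⁰`).  `--supports stmt-HodgeConjecture-24833 --as helper`.  THEOREMS ONLY — no `def`,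
no named fact, no instance, no notation, no `sorry`.  HONEST LABEL: HC_CM is proved only modulo the 7 printed citations (2 remaining named inputs: hLiu418 = stmt-HodgeConjecture-24832,
h413 = stmt-HodgeConjecture-24833) until rung 0 closes; count-neutral plumbing.

THE BINDERS (names as in ★ p855853; `K₁ = Kf ν`; every `x : G` is read in `GL_n(F)` through `e`):
* `paramGL_hSAd` (`S = univ`, trivial) · `paramGL_h𝒩` (`𝒩 = {IsNilpotent}` is closed under scalars: `(a • Z)^k = a^k • Z^k`) — for ★ p855853's `S`∕`𝒩` binders.
* `paramGL_hconjCh` — `Ch X (x⁻¹ a x) = Ch ((e x) X (e x)⁻¹) a` for ALL `x, a` (★ (H-char) `map_trace_mul_coe_conj_sub_one`: cyclicity of the trace; no dictionary).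
* `paramGL_hnd` — ONE-SIDED non-degeneracy `‖X‖ ≤ q^m ⇒ Ch X ≡ 1 on Kf m` (`m ≥ 1` not even needed; ★ (H-char) `map_trace_mul_coe_sub_one_eq_one` + `hdict`).
* `paramGL_hS` — (S): a character `χ : G → ℂ` multiplicative on `Kf N′`, trivial on `Kf N`, of finite-order values (`1 ≤ N′ ≤ N ≤ 2N′`) is `Ch X` on `Kf N′` for some `X ∈ univ`
  (★ adapter `exists_valBound_and_forall_eq_coe_map_trace` through `e`; finite order ⇒ `‖χ a‖ = 1` by Mathlib `Complex.norm_eq_one_of_pow_eq_one`).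
* `norm_conj_eq_of_mem_glInt` ∕ `paramGL_hiso` — `‖(e x) X (e x)⁻¹‖ = ‖X‖` for `e x ∈ GL_n(𝒪)`, resp. `x ∈ Kf 0` (★ `norm_mul_le_of_isUltrametricDist` twice + `hint1`, both directions) ·
  `paramGL_hcontr` — `‖(e x) X (e x)⁻¹ − X‖ ≤ (q^ν)⁻¹‖X‖` for `x ∈ Kf ν`, every `ν` (★ (hA) `norm_conj_sub_le_of_le` + `hlev` + `hint1`).
* `paramGL_hint` — (C) in HEIGHT form with `H := 2h`: `y` of height `≤ h` (`ValBound (|ϖ|^h)⁻¹ (e y)` and `(e y)⁻¹`), `m ≥ 1`, matching of `Ch X (y⁻¹ · y)` and `Ch X′` on the overlap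
  `{a ∈ Kf m : y⁻¹ a y ∈ Kf m}` ⇒ `‖(e y) X (e y)⁻¹ − X′‖ ≤ q^{m+2h}` (★ (C) `valBound_conj_sub_of_intertwines_on_overlap` + `hdict`; `Circle.ext` for the `ℂ`-valued matching).
* `paramGL_hocc` — (N) with `E := 0`: for `1 ≤ ν′ ≤ N′`, `Ch X ≡ 1` on `{a ∈ Kf N′ : x⁻¹ a x ∈ Kf ν′}` ⇒ `X = Z + B`, `Z` nilpotent, `‖B‖ ≤ q^{N′}`
  (★ (N) `exists_nilpotent_add_valBound_of_occurrence` at `e x` + `hdict`; `[IsDiscreteValuationRing 𝒪[F]]`).  `hval`∕`hδm` are (Dict)'s (K2E1b-p01 (g3)).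

## References
* [HarishChandra1999] Harish-Chandra (DeBacker–Sally), *Admissible Invariant Distributions on Reductive p-adic Groups*, ULECT 16 (1999), §17 Thm. 17.1 ∕ Cor. 17.2, §19 Lemmas 19.2–19.4,
  Cor. 19.5, pp. 80–86.
* [Howe1977Kirillov] R. Howe, *Kirillov theory for compact p-adic groups*, Pacific J. Math. 73 (1977), §1.
* [BushnellHenniart2006] C. J. Bushnell, G. Henniart, *The Local Langlands Conjecture for GL(2)*, Grundlehren 335 (2006), §1.1, §1.7.
-/

set_option autoImplicit false
-- the mandated namespace repeats `HodgeConjecture.HodgeConjecture`, as in every `Theorems/*.lean` of this sub-problem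
set_option linter.dupNamespace false

noncomputable section

open Topology Filter Set ValuativeRel Matrix
open Literature.NumberTheory.Automorphic Literature.Analysis.Matrix
open Summit.HodgeConjecture.HodgeConjecture.Cruxes.H413 Summit.HodgeConjecture.HodgeConjecture.Cruxes.H413.K2E3CongruenceFrameGL
open scoped MatrixGroups Matrix.Norms.Elementwise

namespace Summit.HodgeConjecture.HodgeConjecture.Cruxes.H413.K2E3ParameterPackageGL

/-! ## §1 Algebraic binders (no norm): `hSAd`, `h𝒩`, `hconjCh` -/

section Algebra

variable {F : Type*} [Field F] {n : ℕ} {G : Type*} [Group G]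

omit [Group G] in
/-- **`hSAd` for `S = univ`**: trivially `Ad x X ∈ univ` (any `Ad`). [cite: HarishChandra1999, §19 p. 84] -/
theorem paramGL_hSAd {𝔤 : Type*} (K₁ : Set G) (Ad : G → 𝔤 → 𝔤) : ∀ x ∈ K₁, ∀ X ∈ (Set.univ : Set 𝔤), Ad x X ∈ (Set.univ : Set 𝔤) :=
  fun _ _ _ _ => Set.mem_univ _

omit [Group G] in
/-- **`h𝒩`**: the nilpotent matrices are stable under scalars — `(a • Z)^k = a^k • Z^k`. [cite: HarishChandra1999, §19 Lemma 19.3] -/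
theorem paramGL_h𝒩 : ∀ (a : F) (Y : Matrix (Fin n) (Fin n) F), Y ∈ {Z : Matrix (Fin n) (Fin n) F | IsNilpotent Z} → a • Y ∈ {Z : Matrix (Fin n) (Fin n) F | IsNilpotent Z} := by
  rintro a Y ⟨k, hk⟩
  exact ⟨k, by rw [smul_pow, hk, smul_zero]⟩

variable [TopologicalSpace F] [TopologicalSpace G] (e : G ≃ₜ* GL (Fin n) F) {M : Type*} [CommMonoid M] (ψ : AddChar F M)

/-- **`hconjCh` (exact equivariance, ★ p855915's shape)**: with `Ch X g = ι (ψ (tr (X * ((e g) − 1))))` (any reading `ι`, e.g. `Circle → ℂ`),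
`Ch X (x⁻¹ a x) = Ch ((e x) X (e x)⁻¹) a` for ALL `x a : G` (★ (H-char) `map_trace_mul_coe_conj_sub_one` at `κ := (e x)⁻¹`, `k := e a`: cyclicity of the trace).
[cite: Howe1977Kirillov, §1] [cite: HarishChandra1999, §17 p. 81] -/
theorem paramGL_hconjCh {T : Type*} (ι : M → T) (Ch : Matrix (Fin n) (Fin n) F → G → T)
    (hCh : ∀ (X : Matrix (Fin n) (Fin n) F) (g : G), Ch X g = ι (ψ (Matrix.trace (X * (((e g : GL (Fin n) F) : Matrix (Fin n) (Fin n) F) - 1))))) :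
    ∀ (x : G) (X : Matrix (Fin n) (Fin n) F) (a : G),
      Ch X (x⁻¹ * a * x) = Ch (((e x : GL (Fin n) F) : Matrix (Fin n) (Fin n) F) * X * (((e x)⁻¹ : GL (Fin n) F) : Matrix (Fin n) (Fin n) F)) a := by
  intro x X a
  rw [hCh, hCh, map_mul, map_mul, map_inv]
  have h := K2E3CongruenceLayerCharactersGL.map_trace_mul_coe_conj_sub_one ψ X (e x)⁻¹ (e a)
  rw [inv_inv] at h
  rw [h]

end Algebra

/-! ## §2 Normed binders: `hnd`, `hS`, `hiso`, `hcontr`, `hint`, `hocc` (★ p855915's shapes) -/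

section Normed

variable {F : Type*} [NontriviallyNormedField F] [ValuativeRel F] {n : ℕ} {G : Type*} [Group G] [TopologicalSpace G] (e : G ≃ₜ* GL (Fin n) F)
  {ϖ : F} {q : ℝ} (ψ : AddChar F Circle)

/-- **`hnd` (ONE-SIDED NON-DEGENERACY): `‖X‖ ≤ q^m ⇒ Ch X ≡ 1 on Kf m`** — `hdict` turns the norm bound into `ValBound (|ϖ|^m)⁻¹ X`, and ★ (H-char) `map_trace_mul_coe_sub_one_eq_one`
(`ψ` trivial on `𝒪`, `(|ϖ|^m)⁻¹ · |ϖ|^m ≤ 1`) kills `χ_X` on `K_m`; the binder `1 ≤ m` is carried unused. [cite: Howe1977Kirillov, §1] [cite: HarishChandra1999, §17 p. 80] -/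
theorem paramGL_hnd (hϖ : IsUniformizingElement ϖ) (hψ : ∀ x : F, valuation F x ≤ 1 → ψ x = 1)
    (hdict : ∀ (m : ℕ) (X : Matrix (Fin n) (Fin n) F), ValBound (valuation F ϖ ^ m)⁻¹ X ↔ ‖X‖ ≤ q ^ m)
    (Ch : Matrix (Fin n) (Fin n) F → G → ℂ)
    (hCh : ∀ (X : Matrix (Fin n) (Fin n) F) (g : G), Ch X g = ((ψ (Matrix.trace (X * (((e g : GL (Fin n) F) : Matrix (Fin n) (Fin n) F) - 1))) : Circle) : ℂ)) :
    ∀ m : ℕ, 1 ≤ m → ∀ X : Matrix (Fin n) (Fin n) F, ‖X‖ ≤ q ^ m → ∀ a ∈ (congruenceGL n (valuation F ϖ ^ m)).comap e.toMulEquiv.toMonoidHom, Ch X a = 1 := by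
  intro m _ X hX a ha
  have ha' : e a ∈ congruenceGL n (valuation F ϖ ^ m) := (mem_comapGL_congruenceGL_iff e _ a).1 ha
  have hXv : ValBound (valuation F ϖ ^ m)⁻¹ X := (hdict m X).2 hX
  have hle : (valuation F ϖ ^ m)⁻¹ * valuation F ϖ ^ m ≤ 1 :=
    (inv_mul_cancel₀ (pow_ne_zero _ ((Valuation.ne_zero_iff _).2 hϖ.ne_zero))).le
  have h1 := K2E3CongruenceLayerCharactersGL.map_trace_mul_coe_sub_one_eq_one ψ hψ hle hXv ha'
  rw [hCh]
  exact (congrArg (fun z : Circle => (z : ℂ)) h1).trans Circle.coe_one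

/-- **`hS` (EVERY LAYER CHARACTER IS A `Ch X`, ★ p855915's shape)**: for `1 ≤ N′ ≤ N ≤ 2N′`, a function `χ : G → ℂ` multiplicative on `Kf N′`, trivial on `Kf N`, with finite-order
values on `Kf N′` (hence of modulus `1`, Mathlib `Complex.norm_eq_one_of_pow_eq_one`) equals `Ch X` on `Kf N′` for some `X` — ★ adapter `exists_valBound_and_forall_eq_coe_map_trace` for
`χ ∘ e⁻¹`. [cite: Howe1977Kirillov, §1] [cite: HarishChandra1999, §17 Thm. 17.1] -/
theorem paramGL_hS [IsNonarchimedeanLocalField F] (hϖ : IsUniformizingElement ϖ) (hψ : ∀ x : F, valuation F x ≤ 1 → ψ x = 1)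
    (hψ' : ∃ x : F, valuation F x ≤ (valuation F ϖ)⁻¹ ∧ ψ x ≠ 1)
    (Ch : Matrix (Fin n) (Fin n) F → G → ℂ)
    (hCh : ∀ (X : Matrix (Fin n) (Fin n) F) (g : G), Ch X g = ((ψ (Matrix.trace (X * (((e g : GL (Fin n) F) : Matrix (Fin n) (Fin n) F) - 1))) : Circle) : ℂ)) :
    ∀ N' N : ℕ, 1 ≤ N' → N' ≤ N → N ≤ 2 * N' → ∀ χ : G → ℂ,
      (∀ a ∈ (congruenceGL n (valuation F ϖ ^ N')).comap e.toMulEquiv.toMonoidHom, ∀ b ∈ (congruenceGL n (valuation F ϖ ^ N')).comap e.toMulEquiv.toMonoidHom,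
        χ (a * b) = χ a * χ b) →
      (∀ a ∈ (congruenceGL n (valuation F ϖ ^ N)).comap e.toMulEquiv.toMonoidHom, χ a = 1) →
      (∀ a ∈ (congruenceGL n (valuation F ϖ ^ N')).comap e.toMulEquiv.toMonoidHom, ∃ m : ℕ, 0 < m ∧ χ a ^ m = 1) →
      ∃ X : Matrix (Fin n) (Fin n) F, ∀ a ∈ (congruenceGL n (valuation F ϖ ^ N')).comap e.toMulEquiv.toMonoidHom, χ a = Ch X a := by
  intro N' N hN' hle h2 χ hmul htriv hfin
  -- the character read on `GL_n(F)`
  have hmul' : ∀ k ∈ congruenceGL n (valuation F ϖ ^ N'), ∀ k' ∈ congruenceGL n (valuation F ϖ ^ N'), (χ ∘ e.symm) (k * k') = (χ ∘ e.symm) k * (χ ∘ e.symm) k' := by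
    intro k hk k' hk'
    have hk₁ : e.symm k ∈ (congruenceGL n (valuation F ϖ ^ N')).comap e.toMulEquiv.toMonoidHom :=
      (mem_comapGL_congruenceGL_iff e _ _).2 (by rw [e.apply_symm_apply]; exact hk)
    have hk₂ : e.symm k' ∈ (congruenceGL n (valuation F ϖ ^ N')).comap e.toMulEquiv.toMonoidHom :=
      (mem_comapGL_congruenceGL_iff e _ _).2 (by rw [e.apply_symm_apply]; exact hk')
    simp only [Function.comp_apply, map_mul]
    exact hmul _ hk₁ _ hk₂
  have htriv' : ∀ k ∈ congruenceGL n (valuation F ϖ ^ N), (χ ∘ e.symm) k = 1 := by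
    intro k hk
    have hk₁ : e.symm k ∈ (congruenceGL n (valuation F ϖ ^ N)).comap e.toMulEquiv.toMonoidHom :=
      (mem_comapGL_congruenceGL_iff e _ _).2 (by rw [e.apply_symm_apply]; exact hk)
    exact htriv _ hk₁
  have hnorm' : ∀ k ∈ congruenceGL n (valuation F ϖ ^ N'), ‖(χ ∘ e.symm) k‖ = 1 := by
    intro k hk
    have hk₁ : e.symm k ∈ (congruenceGL n (valuation F ϖ ^ N')).comap e.toMulEquiv.toMonoidHom :=
      (mem_comapGL_congruenceGL_iff e _ _).2 (by rw [e.apply_symm_apply]; exact hk)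
    obtain ⟨j, hj, hjk⟩ := hfin _ hk₁
    exact Complex.norm_eq_one_of_pow_eq_one hjk (Nat.pos_iff_ne_zero.1 hj)
  obtain ⟨X, -, hX⟩ := K2E3CongruenceLayerAdapters.exists_valBound_and_forall_eq_coe_map_trace hϖ hψ hψ' hN' hle h2 (χ ∘ e.symm) hmul' htriv' hnorm'
  refine ⟨X, fun a ha => ?_⟩
  have h := hX (e a) ha
  rw [Function.comp_apply, e.symm_apply_apply] at h
  rw [hCh, h]

variable [IsUltrametricDist F]

/-- **ISOMETRY ON THE INTEGRAL POINTS: `‖(e x) X (e x)⁻¹‖ = ‖X‖` whenever `e x ∈ GL_n(𝒪)`**: `‖k X k⁻¹‖ ≤ ‖k‖‖X‖‖k⁻¹‖ ≤ ‖X‖` by the ultrametric submultiplicativity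
★ `norm_mul_le_of_isUltrametricDist` and `hint1`, and symmetrically `X = k⁻¹ (k X k⁻¹) k`. [cite: HarishChandra1999, §17 p. 80] [cite: BushnellHenniart2006, §1.1] -/
theorem norm_conj_eq_of_mem_glInt (hint1 : ∀ k : GL (Fin n) F, k ∈ glInt n F → ‖(k : Matrix (Fin n) (Fin n) F)‖ ≤ 1)
    {x : G} (hx : e x ∈ glInt n F) (X : Matrix (Fin n) (Fin n) F) :
    ‖((e x : GL (Fin n) F) : Matrix (Fin n) (Fin n) F) * X * (((e x)⁻¹ : GL (Fin n) F) : Matrix (Fin n) (Fin n) F)‖ = ‖X‖ := by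
  have h1 : ‖((e x : GL (Fin n) F) : Matrix (Fin n) (Fin n) F)‖ ≤ 1 := hint1 _ hx
  have h2 : ‖(((e x)⁻¹ : GL (Fin n) F) : Matrix (Fin n) (Fin n) F)‖ ≤ 1 := hint1 _ (Subgroup.inv_mem _ hx)
  have key : ∀ (A B Y : Matrix (Fin n) (Fin n) F), ‖A‖ ≤ 1 → ‖B‖ ≤ 1 → ‖A * Y * B‖ ≤ ‖Y‖ := by
    intro A B Y hA hB
    calc ‖A * Y * B‖ ≤ ‖A * Y‖ * ‖B‖ := norm_mul_le_of_isUltrametricDist _ _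
      _ ≤ (‖A‖ * ‖Y‖) * ‖B‖ := mul_le_mul_of_nonneg_right (norm_mul_le_of_isUltrametricDist _ _) (norm_nonneg _)
      _ ≤ (1 * ‖Y‖) * 1 := by gcongr
      _ = ‖Y‖ := by ring
  apply le_antisymm (key _ _ _ h1 h2)
  have hX : X = (((e x)⁻¹ : GL (Fin n) F) : Matrix (Fin n) (Fin n) F) *
      (((e x : GL (Fin n) F) : Matrix (Fin n) (Fin n) F) * X * (((e x)⁻¹ : GL (Fin n) F) : Matrix (Fin n) (Fin n) F)) * ((e x : GL (Fin n) F) : Matrix (Fin n) (Fin n) F) := by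
    rw [← Matrix.mul_assoc, ← Matrix.mul_assoc, Units.inv_mul, Matrix.one_mul, Matrix.mul_assoc, Units.inv_mul, Matrix.mul_one]
  conv_lhs => rw [hX]
  exact key _ _ _ h2 h1

/-- **`hiso` (★ p855915's shape, on `Kf 0 = e⁻¹ K_{|ϖ|^0}`)**: `‖(e x) X (e x)⁻¹‖ = ‖X‖` for `x ∈ Kf 0` (`K_1 ≤ GL_n(𝒪)`). [cite: HarishChandra1999, §17 p. 80] -/
theorem paramGL_hiso (hint1 : ∀ k : GL (Fin n) F, k ∈ glInt n F → ‖(k : Matrix (Fin n) (Fin n) F)‖ ≤ 1) :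
    ∀ x ∈ (congruenceGL n (valuation F ϖ ^ 0)).comap e.toMulEquiv.toMonoidHom, ∀ X : Matrix (Fin n) (Fin n) F,
      ‖((e x : GL (Fin n) F) : Matrix (Fin n) (Fin n) F) * X * ((e x)⁻¹ : GL (Fin n) F)‖ = ‖X‖ :=
  fun _ hx X => norm_conj_eq_of_mem_glInt e hint1 (congruenceGL_le_glInt _ hx) X

/-- **`hcontr` (★ p855915's shape, every `ν`): `‖(e x) X (e x)⁻¹ − X‖ ≤ (q^ν)⁻¹ ‖X‖`** for `x ∈ Kf ν` (★ (hA) `norm_conj_sub_le_of_le` with `δ := (q^ν)⁻¹` from `hlev`, `‖(e x)⁻¹‖ ≤ 1`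
from `hint1`). [cite: HarishChandra1999, §17 p. 80] [cite: BushnellHenniart2006, §1.1] -/
theorem paramGL_hcontr (hint1 : ∀ k : GL (Fin n) F, k ∈ glInt n F → ‖(k : Matrix (Fin n) (Fin n) F)‖ ≤ 1)
    (hlev : ∀ (m : ℕ) (k : GL (Fin n) F), k ∈ congruenceGL n (valuation F ϖ ^ m) → ‖(k : Matrix (Fin n) (Fin n) F) - 1‖ ≤ (q ^ m)⁻¹) :
    ∀ ν : ℕ, ∀ x ∈ (congruenceGL n (valuation F ϖ ^ ν)).comap e.toMulEquiv.toMonoidHom, ∀ X : Matrix (Fin n) (Fin n) F,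
      ‖((e x : GL (Fin n) F) : Matrix (Fin n) (Fin n) F) * X * ((e x)⁻¹ : GL (Fin n) F) - X‖ ≤ (q ^ ν)⁻¹ * ‖X‖ :=
  fun ν _ hx X => K2E3RegularAdjointConeEstimates.norm_conj_sub_le_of_le (e _) (hlev ν _ hx) (hint1 _ (Subgroup.inv_mem _ (congruenceGL_le_glInt _ hx))) X

omit [IsUltrametricDist F] in
/-- **`hint` IN HEIGHT FORM (★ p855915's shape; (C) with `H := 2h`)**: for `y` of height `≤ h` (`ValBound (|ϖ|^h)⁻¹` on the matrices of `e y` and `(e y)⁻¹`) and `m ≥ 1`, matching of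
`Ch X (y⁻¹ · y)` and `Ch X′` on the overlap `{a ∈ Kf m : y⁻¹ a y ∈ Kf m}` forces `‖(e y) X (e y)⁻¹ − X′‖ ≤ q^{m+2h}` — ★ (C) `valBound_conj_sub_of_intertwines_on_overlap` read through `e`
(`Circle.ext` for the `ℂ`-valued matching) and `hdict`. [cite: HarishChandra1999, §17 Cor. 17.2, §19 Lemma 19.4] [cite: Howe1977Kirillov, §1] -/
theorem paramGL_hint (hϖ : IsUniformizingElement ϖ) (hψ : ∀ x : F, valuation F x ≤ 1 → ψ x = 1) (hψ' : ∃ x : F, valuation F x ≤ (valuation F ϖ)⁻¹ ∧ ψ x ≠ 1)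
    (hdict : ∀ (m : ℕ) (X : Matrix (Fin n) (Fin n) F), ValBound (valuation F ϖ ^ m)⁻¹ X ↔ ‖X‖ ≤ q ^ m)
    (Ch : Matrix (Fin n) (Fin n) F → G → ℂ)
    (hCh : ∀ (X : Matrix (Fin n) (Fin n) F) (g : G), Ch X g = ((ψ (Matrix.trace (X * (((e g : GL (Fin n) F) : Matrix (Fin n) (Fin n) F) - 1))) : Circle) : ℂ)) :
    ∀ (h : ℕ) (y : G), ValBound (valuation F ϖ ^ h)⁻¹ ((e y : GL (Fin n) F) : Matrix (Fin n) (Fin n) F) →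
      ValBound (valuation F ϖ ^ h)⁻¹ (((e y)⁻¹ : GL (Fin n) F) : Matrix (Fin n) (Fin n) F) →
      ∀ m : ℕ, 1 ≤ m → ∀ X X' : Matrix (Fin n) (Fin n) F,
        (∀ a ∈ (congruenceGL n (valuation F ϖ ^ m)).comap e.toMulEquiv.toMonoidHom, y⁻¹ * a * y ∈ (congruenceGL n (valuation F ϖ ^ m)).comap e.toMulEquiv.toMonoidHom →
          Ch X (y⁻¹ * a * y) = Ch X' a) →
        ‖((e y : GL (Fin n) F) : Matrix (Fin n) (Fin n) F) * X * ((e y)⁻¹ : GL (Fin n) F) - X'‖ ≤ q ^ (m + 2 * h) := by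
  intro h y hy₁ hy₂ m hm X X' hmatch
  have hover : ∀ k ∈ congruenceGL n (valuation F ϖ ^ m), (e y)⁻¹ * k * (e y) ∈ congruenceGL n (valuation F ϖ ^ m) →
      ψ (Matrix.trace (X * ((((e y)⁻¹ * k * (e y) : GL (Fin n) F) : Matrix (Fin n) (Fin n) F) - 1))) = ψ (Matrix.trace (X' * ((k : Matrix (Fin n) (Fin n) F) - 1))) := by
    intro k hk hk'
    have hk₁ : e.symm k ∈ (congruenceGL n (valuation F ϖ ^ m)).comap e.toMulEquiv.toMonoidHom :=
      (mem_comapGL_congruenceGL_iff e _ _).2 (by rw [e.apply_symm_apply]; exact hk)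
    have hek : e (y⁻¹ * e.symm k * y) = (e y)⁻¹ * k * e y := by rw [map_mul, map_mul, map_inv, e.apply_symm_apply]
    have hk₂ : y⁻¹ * e.symm k * y ∈ (congruenceGL n (valuation F ϖ ^ m)).comap e.toMulEquiv.toMonoidHom :=
      (mem_comapGL_congruenceGL_iff e _ _).2 (by rw [hek]; exact hk')
    have h := hmatch (e.symm k) hk₁ hk₂
    rw [hCh, hCh, hek, e.apply_symm_apply] at h
    exact Circle.ext h
  have hC := K2E3CongruenceLayerIntertwiningGL.valBound_conj_sub_of_intertwines_on_overlap ψ hϖ hψ hψ' m h (by omega) hy₁ hy₂ hover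
  exact (hdict (m + 2 * h) _).1 hC

omit [IsUltrametricDist F] in
/-- **`hocc` (★ p855915's shape; (N) with `E := 0`)**: for `1 ≤ ν′ ≤ N′`, if `Ch X ≡ 1` on `{a ∈ Kf N′ : x⁻¹ a x ∈ Kf ν′}` then `X = Z + B` with `Z` NILPOTENT and `‖B‖ ≤ q^{N′}` —
★ (N) `exists_nilpotent_add_valBound_of_occurrence` at `e x` (GL-Cartan of `e x`) + `hdict`. [cite: HarishChandra1999, §19 Lemma 19.3, §20] [cite: Howe1977Kirillov, §1] -/
theorem paramGL_hocc [IsDiscreteValuationRing 𝒪[F]] (hϖ : IsUniformizingElement ϖ) (hψ' : ∃ x : F, valuation F x ≤ (valuation F ϖ)⁻¹ ∧ ψ x ≠ 1)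
    (hdict : ∀ (m : ℕ) (X : Matrix (Fin n) (Fin n) F), ValBound (valuation F ϖ ^ m)⁻¹ X ↔ ‖X‖ ≤ q ^ m)
    (Ch : Matrix (Fin n) (Fin n) F → G → ℂ)
    (hCh : ∀ (X : Matrix (Fin n) (Fin n) F) (g : G), Ch X g = ((ψ (Matrix.trace (X * (((e g : GL (Fin n) F) : Matrix (Fin n) (Fin n) F) - 1))) : Circle) : ℂ)) :
    ∀ ν' N' : ℕ, 1 ≤ ν' → ν' ≤ N' → ∀ X : Matrix (Fin n) (Fin n) F, ∀ x : G,
      (∀ a ∈ (congruenceGL n (valuation F ϖ ^ N')).comap e.toMulEquiv.toMonoidHom,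
        x⁻¹ * a * x ∈ (congruenceGL n (valuation F ϖ ^ ν')).comap e.toMulEquiv.toMonoidHom → Ch X a = 1) →
      ∃ Z B : Matrix (Fin n) (Fin n) F, IsNilpotent Z ∧ ‖B‖ ≤ q ^ N' ∧ X = Z + B := by
  intro ν' N' hν' hνN X x hocc
  have hocc' : ∀ k ∈ congruenceGL n (valuation F ϖ ^ N'), (e x)⁻¹ * k * (e x) ∈ congruenceGL n (valuation F ϖ ^ ν') →
      ψ (Matrix.trace (X * ((k : Matrix (Fin n) (Fin n) F) - 1))) = 1 := by
    intro k hk hk'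
    have hk₁ : e.symm k ∈ (congruenceGL n (valuation F ϖ ^ N')).comap e.toMulEquiv.toMonoidHom :=
      (mem_comapGL_congruenceGL_iff e _ _).2 (by rw [e.apply_symm_apply]; exact hk)
    have hek : e (x⁻¹ * e.symm k * x) = (e x)⁻¹ * k * e x := by rw [map_mul, map_mul, map_inv, e.apply_symm_apply]
    have hk₂ : x⁻¹ * e.symm k * x ∈ (congruenceGL n (valuation F ϖ ^ ν')).comap e.toMulEquiv.toMonoidHom :=
      (mem_comapGL_congruenceGL_iff e _ _).2 (by rw [hek]; exact hk')
    have h := hocc (e.symm k) hk₁ hk₂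
    rw [hCh, e.apply_symm_apply] at h
    exact Circle.ext (h.trans Circle.coe_one.symm)
  obtain ⟨Z, B, hZ, hB, hXZB⟩ := K2E3CongruenceLayerOccurrenceNilpotentGL.exists_nilpotent_add_valBound_of_occurrence ψ hϖ hψ' hν' hνN (e x) hocc'
  exact ⟨Z, B, hZ, (hdict N' B).1 hB, hXZB⟩

end Normed

end Summit.HodgeConjecture.HodgeConjecture.Cruxes.H413.K2E3ParameterPackageGL

end
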